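import Mathlib.Analysis.Calculus.Deriv.Star
import Literature.NumberTheory.EllipticCurves.Gamma1NewformLSeries
import Literature.NumberTheory.EllipticCurves.CuspFormLFunctionFrickeProofs
import HarnessLib

/-!
# The weight-one functional equation `Λ_f(1 - s) = a Λ_{f̃}(s)` from `f(-1/Nz) = λ z f̃(z)`
(Deligne–Serre 1974, proof of Thm. 4.6, step (i): the Mellin-transform half, proved)

D-0014 keeps `Literature/` sorry-free by stating cited results as named facts `def X : Prop`.
The named fact `DeligneSerre1974.weightOne_functionalEquation` of
`Literature.NumberTheory.EllipticCurves.Gamma1NewformLSeries` is step (i) of the proof of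
Deligne–Serre, *Formes modulaires de poids 1*, Ann. Sci. ÉNS (4) 7 (1974), Thm. 4.6, p. 515:
"Posons `f̃ = Σ ā_n qⁿ`.  Du fait que `f` est primitive, il existe une constante `λ ≠ 0` telle
que `f(-1/Nz) = λ z f̃(z)`, cf. [12] et [13].  Par transformation de Mellin, on en déduit que
`Λ_f(1 - s) = a Λ_{f̃}(s)` avec … où `Λ_g(s) = N^{s/2} (2π)^{-s} Γ(s) Φ_g(s)` et
`Φ_g(s) = Σ a_n(g) n^{-s}`."  It is one of the two remaining undischarged inputs of
`Literature.NumberTheory.Automorphic.deligneSerre_eulerPolynomial_eq_of_dvd_level` (Thm. 4.6 (b) at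
`p ∣ N`; see `Literature.NumberTheory.Automorphic.DeligneSerreThm46bProofs`).  The printed step
has two halves of very different nature:

1. (**Atkin–Lehner–Li**, algebraic) a newform `f ∈ S_1(Γ₁(N))` satisfies
   `f(-1/(Nz)) = λ z f̃(z)` with `λ ≠ 0`, where `f̃(z) = conj f(-z̄) = Σ ā_n qⁿ` — the
   `W_N`-pseudo-eigenvalue theorem (Li, *Newforms and functional equations*, Math. Ann. 212
   (1975); Miyake, Ann. of Math. 94 (1971)), resting on multiplicity one for newforms on `Γ₁(N)`
   with nebentypus, which the tree has for `Γ₀(N)` only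
   (`Literature.NumberTheory.EllipticCurves.NewformsMultiplicityOneProofs`,
   `IsNewform0.exists_frickeInvolution_eq_smul_holds`);
2. (**Hecke**, analytic) the Mellin transform turns the relation of 1 into
   `Λ_f(1 - s) = a Λ_{f̃}(s)`, `a ≠ 0`, for the entire continuations of the completed series.

This file **proves half 2** in all weights `k ≥ -2` and for every arithmetic subgroup whose cusp
`∞` has width `1`, and records the resulting reduction of the named fact to half 1:

* `exists_functionalEquation_of_fricke_conj` — if `f ∈ S_k(Γ)` satisfies
  `f(w_N z) = λ z^k conj f(-z̄)` for all `z ∈ ℍ` (`w_N = (0 -1; N 0)`, the tree's `frickeGL N`),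
  then `Λ(s) = N^{s/2} ∫₀^∞ f(it) t^{s-1} dt` and `Λ'(s) = N^{s/2} ∫₀^∞ conj f(it) t^{s-1} dt` are
  entire continuations of `Λ_f` (`completedCuspFormLContinuations N f`) and of `Λ_{f̃}`
  (`completedConjCuspFormLContinuations N f`, built on `Φ_{f̃}(s) = Σ ā_n n^{-s}`), and
  `Λ(k - s) = λ i^k N^{-k/2} Λ'(s)`.  Ingredients: the tree's Mellin machinery for cusp forms
  (`differentiable_mellin_imagAxis`, `mellin_imagAxis_eq` of `CuspFormLFunctionProofs`;
  `coe_frickeGL_smul_I_mul`, `mellin_congr_Ioi` of `CuspFormLFunctionFrickeProofs`), the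
  reflection identities `𝓜(conj F)(s) = conj 𝓜F(conj s)` (`mellin_conj`),
  `Σ ā_n n^{-s} = conj Φ_f(conj s)` (`LSeries_conj`, `conjCuspFormLSeries_eq_conj`) and
  `Γ(conj s) = conj Γ(s)`, whence `Λ'` continues `Λ_{f̃}`
  (`cpow_mul_mellin_conj_imagAxis_mem_completedConjCuspFormLContinuations`), and the
  substitution `t ↦ 1/(Nt)` (`cpow_mul_mellin_imagAxis_neg_eq_of_conj`, Mathlib
  `mellin_comp_inv`, `mellin_comp_mul_left`, `mellin_cpow_smul`).
* `exists_weightOne_functionalEquation_of_fricke_conj` — weight one: `a = λ i N^{-1/2} ≠ 0`.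
* `DeligneSerre1974.weightOne_functionalEquation_of_fricke_conj` — **the named fact
  `weightOne_functionalEquation` at level `N` from half 1 alone** (hypothesis: every newform
  `f ∈ S_1(Γ₁(N))` satisfies `f(w_N z) = λ z conj f(-z̄)` for some `λ ≠ 0`).  Once the
  `W_N`-pseudo-eigenvalue theorem for `Γ₁(N)` is in the tree, `weightOne_functionalEquation_holds`
  is this theorem applied to it.

## References

* P. Deligne, J.-P. Serre, *Formes modulaires de poids 1*, Ann. Sci. ÉNS (4) 7 (1974),
  507–530, doi:10.24033/asens.1277 — §4 (b), proof of Thm. 4.6, step (i), p. 515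
  (`DeligneSerreASENS1974`).
* E. Hecke, *Über die Bestimmung Dirichletscher Reihen durch ihre Funktionalgleichung*,
  Math. Ann. 112 (1936), 664–699 (`Hecke1936`).
* F. Diamond, J. Shurman, *A First Course in Modular Forms*, GTM 228, Springer 2005, §5.10,
  Thm. 5.10.2 (`DiamondShurman2005`).
* W.-C. W. Li, *Newforms and functional equations*, Math. Ann. 212 (1975), 285–315 (`Li1975`).
-/

noncomputable section

open scoped MatrixGroups ModularForm ComplexConjugate

open CongruenceSubgroup UpperHalfPlane Complex Filter Topology Asymptotics Set MeasureTheory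

namespace Literature.NumberTheory.EllipticCurves.ModularForms

/-! ### Complex conjugation and Mellin transforms / Dirichlet series -/

/-- `conj (t ^ w) = t ^ (conj w)` for real `t ≥ 0` (principal branch; Mathlib `Complex.cpow_conj`
with `arg t = 0`). [folklore] -/
theorem conj_ofReal_cpow {t : ℝ} (ht : 0 ≤ t) (w : ℂ) :
    conj ((t : ℂ) ^ w) = (t : ℂ) ^ conj w := by
  have harg : (t : ℂ).arg ≠ Real.pi := by
    rw [arg_ofReal_of_nonneg ht]
    exact Real.pi_ne_zero.symm
  have h := cpow_conj (t : ℂ) w harg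
  rw [conj_ofReal] at h
  rw [h]

/-- **Mellin transform of the complex conjugate**: `𝓜(conj ∘ F)(s) = conj (𝓜 F (conj s))`
(conjugate under the integral sign, `integral_conj`, and `conj t^{conj s - 1} = t^{s-1}` for
`t > 0`). [folklore] -/
theorem mellin_conj (F : ℝ → ℂ) (s : ℂ) :
    mellin (fun t ↦ conj (F t)) s = conj (mellin F (conj s)) := by
  rw [mellin, mellin, ← integral_conj]
  refine setIntegral_congr_fun measurableSet_Ioi fun t ht ↦ ?_
  simp only [smul_eq_mul, map_mul]
  rw [conj_ofReal_cpow (le_of_lt ht), map_sub, map_one, conj_conj]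

/-- **Dirichlet series with conjugate coefficients**: `Σ conj(aₙ) n^{-s} = conj (Σ aₙ n^{-conj s})`
as an identity of `LSeries` values (termwise, `Complex.conj_tsum`; both sides are junk together
off the half-plane of convergence). [folklore] -/
theorem LSeries_conj (a : ℕ → ℂ) (s : ℂ) :
    LSeries (fun n ↦ conj (a n)) s = conj (LSeries a (conj s)) := by
  rw [LSeries, LSeries, conj_tsum]
  refine tsum_congr fun n ↦ ?_
  rcases Nat.eq_zero_or_pos n with rfl | hn
  · simp [LSeries.term_zero]
  · rw [LSeries.term_of_ne_zero hn.ne', LSeries.term_of_ne_zero hn.ne', map_div₀,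
      ← ofReal_natCast, conj_ofReal_cpow (Nat.cast_nonneg n), conj_conj]

/-- `Φ_{f̃}(s) = conj Φ_f(conj s)`: the conjugate-coefficient series is the reflection of the
`L`-series of `f` in the real axis. [folklore] -/
theorem conjCuspFormLSeries_eq_conj {Γ : Subgroup (GL (Fin 2) ℝ)} {k : ℤ} (f : CuspForm Γ k)
    (s : ℂ) : conjCuspFormLSeries f s = conj (cuspFormLSeries f (conj s)) := by
  rw [conjCuspFormLSeries, cuspFormLSeries, LSeries_conj]

/-! ### Mellin transforms along the imaginary axis: `f(it)` and `conj f(it) = f̃(it)` -/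

section ImagAxis

/- Throughout, `fun t : ℝ ↦ (f : ℍ → ℂ) (UpperHalfPlane.ofComplex (Complex.I * (t : ℂ)))` is
the restriction `t ↦ f(it)` of `f` to the imaginary axis (the `𝕀[f]` of
`CuspFormLFunctionProofs`, written out). -/

variable {Γ : Subgroup (GL (Fin 2) ℝ)} {k : ℤ} [Γ.IsArithmetic]

/-- **`Λ(s) = N^{s/2} ∫₀^∞ f(it) t^{s-1} dt` is an entire continuation of `Λ_N(f, s)`** for a cusp
form `f` of weight `k ≥ -2` on an arithmetic subgroup whose cusp `∞` has width `1` (e.g.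
`Γ₁(N)`, `Γ₀(N)`): entire by `differentiable_mellin_imagAxis`, equal to
`N^{s/2} (2π)^{-s} Γ(s) L(f, s)` on `re s > k/2 + 1` by `mellin_imagAxis_eq` (the level-`Γ`
version of `cpow_mul_mellin_mem_completedCuspFormLContinuations`; Hecke 1936, Diamond–Shurman
Thm. 5.10.2). [cite: DiamondShurman2005, Thm. 5.10.2] -/
theorem cpow_mul_mellin_imagAxis_mem_completedCuspFormLContinuations (hk : -2 ≤ k)
    (hΓ : Γ.strictWidthInfty = 1) (N : ℕ) [NeZero N] (f : CuspForm Γ k) :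
    (fun s ↦ (N : ℂ) ^ (s / 2) *
        mellin (fun t : ℝ ↦ (f : ℍ → ℂ) (UpperHalfPlane.ofComplex (Complex.I * (t : ℂ)))) s) ∈
      completedCuspFormLContinuations N f := by
  have hN : (N : ℂ) ≠ 0 := by exact_mod_cast NeZero.ne N
  refine ⟨fun s ↦ ?_, fun s hs ↦ ?_⟩
  · exact ((differentiableAt_id.div_const 2).const_cpow (Or.inl hN)).mul
      (differentiable_mellin_imagAxis f s)
  · have hk' : (-2 : ℝ) ≤ k := by exact_mod_cast hk
    have hs₀ : 0 < s.re := by linarith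
    dsimp only
    rw [mellin_imagAxis_eq hΓ f hs hs₀, completedCuspFormL]
    ring

/-- The Mellin transform of `t ↦ conj f(it)` (the values `f̃(it)` of the conjugate form
`f̃(z) = conj f(-z̄)` on the imaginary axis) is the reflection `s ↦ conj 𝓜(f(i·))(conj s)` of the
Mellin transform of `f(it)` (`mellin_conj`), hence entire (`differentiable_mellin_imagAxis`,
Mathlib `DifferentiableAt.conj_conj`). [folklore] -/
theorem differentiable_mellin_conj_imagAxis (f : CuspForm Γ k) :
    Differentiable ℂ
      (mellin fun t : ℝ ↦ conj ((f : ℍ → ℂ) (UpperHalfPlane.ofComplex (Complex.I * (t : ℂ))))) := by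
  have heq : (mellin fun t : ℝ ↦ conj ((f : ℍ → ℂ) (UpperHalfPlane.ofComplex (Complex.I * (t : ℂ))))) =
      conj ∘ mellin (fun t : ℝ ↦ (f : ℍ → ℂ) (UpperHalfPlane.ofComplex (Complex.I * (t : ℂ)))) ∘
        conj := by
    funext s
    exact mellin_conj _ s
  rw [heq]
  intro s
  exact differentiableAt_conj_conj_iff.mpr (differentiable_mellin_imagAxis f (conj s))

/-- **`Λ'(s) = N^{s/2} ∫₀^∞ conj f(it) t^{s-1} dt` is an entire continuation of `Λ_{f̃}(s)`**, the
completed conjugate-coefficient series `completedConjCuspFormL N f` (`k ≥ -2`, cusp `∞` of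
width `1`): on `re s > k/2 + 1`,
`𝓜(conj f(i·))(s) = conj 𝓜(f(i·))(conj s) = conj ((2π)^{-conj s} Γ(conj s) Φ_f(conj s))
 = (2π)^{-s} Γ(s) Φ_{f̃}(s)` (`mellin_conj`, `mellin_imagAxis_eq`, `Complex.Gamma_conj`,
`conjCuspFormLSeries_eq_conj`).  This is the Mellin transform of `f̃ = Σ ā_n qⁿ` in
Deligne–Serre's step (i) ("`Λ_{f̃}(s)`"). [cite: DeligneSerreASENS1974, §4 (b) proof of Thm. 4.6 (i)] -/
theorem cpow_mul_mellin_conj_imagAxis_mem_completedConjCuspFormLContinuations (hk : -2 ≤ k)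
    (hΓ : Γ.strictWidthInfty = 1) (N : ℕ) [NeZero N] (f : CuspForm Γ k) :
    (fun s ↦ (N : ℂ) ^ (s / 2) *
        mellin (fun t : ℝ ↦ conj ((f : ℍ → ℂ) (UpperHalfPlane.ofComplex (Complex.I * (t : ℂ))))) s) ∈
      completedConjCuspFormLContinuations N f := by
  have hN : (N : ℂ) ≠ 0 := by exact_mod_cast NeZero.ne N
  refine ⟨fun s ↦ ?_, fun s hs ↦ ?_⟩
  · exact ((differentiableAt_id.div_const 2).const_cpow (Or.inl hN)).mul
      (differentiable_mellin_conj_imagAxis f s)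
  · have hk' : (-2 : ℝ) ≤ k := by exact_mod_cast hk
    have hs₀ : 0 < s.re := by linarith
    have hs' : (k : ℝ) / 2 + 1 < (conj s).re := by rwa [conj_re]
    have hs₀' : 0 < (conj s).re := by rwa [conj_re]
    dsimp only
    rw [mellin_conj, mellin_imagAxis_eq hΓ f hs' hs₀', completedConjCuspFormL,
      conjCuspFormLSeries_eq_conj, map_mul, map_mul, Complex.Gamma_conj, conj_conj,
      ← ofReal_ofNat, ← ofReal_mul, conj_ofReal_cpow (by positivity), map_neg, conj_conj]
    push_cast
    ring

end ImagAxis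

/-! ### From `f(-1/Nz) = λ z^k f̃(z)` to `Λ_f(k - s) = a Λ_{f̃}(s)` -/

section Fricke

variable {N : ℕ} [NeZero N]

/-- **The `W_N`-relation on the imaginary axis.**  If `f(-1/(Nz)) = λ z^k conj f(-z̄)` for all
`z ∈ ℍ` (i.e. `f(w_N z) = λ z^k f̃(z)` with `f̃(z) = conj f(-z̄)`, the form with the
complex-conjugate Fourier coefficients; `w_N = (0 -1; N 0)` is `frickeGL N`), then for `t > 0`,
`f(i/(Nt)) = λ (it)^k conj f(it)`: `w_N (it) = i/(Nt)` (`coe_frickeGL_smul_I_mul`) and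
`-conj(it) = it`. [cite: DeligneSerreASENS1974, §4 (b) proof of Thm. 4.6 (i)] -/
theorem imagAxis_mul_inv_eq_of_fricke_conj (f : ℍ → ℂ) (k : ℤ) {lam : ℂ}
    (hW : ∀ z : ℍ, f (glCast (frickeGL N : GL (Fin 2) ℚ) • z) =
      lam * (z : ℂ) ^ k * conj (f ⟨-conj (z : ℂ), by simpa using z.im_pos⟩))
    {t : ℝ} (ht : 0 < t) :
    f (UpperHalfPlane.ofComplex (Complex.I * ((((N : ℝ) * t)⁻¹ : ℝ) : ℂ))) =
      lam * (Complex.I * t) ^ k * conj (f (UpperHalfPlane.ofComplex (Complex.I * (t : ℂ)))) := by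
  have hNt : 0 < (N : ℝ) * t := mul_pos (by exact_mod_cast NeZero.pos N) ht
  set z : ℍ := ⟨Complex.I * t, by simpa using ht⟩ with hz
  have hpt : (glCast (frickeGL N : GL (Fin 2) ℚ) • z : ℍ) =
      ⟨Complex.I * ((N * t)⁻¹ : ℝ), by simpa using inv_pos.mpr hNt⟩ :=
    UpperHalfPlane.ext (coe_frickeGL_smul_I_mul N ht)
  have hneg : (⟨-conj (z : ℂ), by simpa using z.im_pos⟩ : ℍ) = z := by
    apply UpperHalfPlane.ext
    simp [hz]
  have h := hW z
  rw [hpt, hneg] at h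
  rw [ofComplex_apply_of_im_pos (z := Complex.I * ((((N : ℝ) * t)⁻¹ : ℝ) : ℂ))
      (by simpa using inv_pos.mpr hNt),
    ofComplex_apply_of_im_pos (z := Complex.I * (t : ℂ)) (by simpa using ht)]
  exact h

/-- **Mellin transforms under the relation `F(1/(Nt)) = λ (it)^k conj F(t)`**: for any
`F : (0, ∞) → ℂ` with this symmetry, `N^{-s} 𝓜F(-s) = λ i^k 𝓜(conj F)(s + k)` for every `s`
(substitute `t ↦ 1/(Nt)`: Mathlib `mellin_comp_mul_left`, `mellin_comp_inv`, `mellin_cpow_smul`;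
both sides vanish together where the integrals diverge).  With `F(t) = f(it)` this is the
computation behind Hecke's "transformation de Mellin" in Deligne–Serre's step (i), cf.
`cpow_mul_mellin_imagAxis_neg_eq` for `Γ₀(N)`. [cite: DeligneSerreASENS1974, §4 (b) proof of Thm. 4.6 (i)] -/
theorem cpow_mul_mellin_neg_eq_mellin_conj (F : ℝ → ℂ) (k : ℤ) {lam : ℂ}
    (hax : ∀ t : ℝ, 0 < t → F ((N : ℝ) * t)⁻¹ = lam * (Complex.I * t) ^ k * conj (F t))
    (s : ℂ) :
    (N : ℂ) ^ (-s) * mellin F (-s) =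
      lam * Complex.I ^ k * mellin (fun t ↦ conj (F t)) (s + k) := by
  have hNpos : (0 : ℝ) < N := by exact_mod_cast NeZero.pos N
  have hlhs : mellin (fun t : ℝ ↦ F ((N : ℝ) * t)⁻¹) s = (N : ℂ) ^ (-s) * mellin F (-s) := by
    have h := mellin_comp_mul_left (fun u : ℝ ↦ F u⁻¹) s hNpos
    have h' := mellin_comp_inv F s
    beta_reduce at h h' ⊢
    rw [h', Complex.ofReal_natCast, smul_eq_mul] at h
    exact h
  have hrhs : mellin (fun t : ℝ ↦ lam * Complex.I ^ k * (t : ℂ) ^ (k : ℂ) * conj (F t)) s =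
      lam * Complex.I ^ k * mellin (fun t ↦ conj (F t)) (s + k) := by
    have h := mellin_const_smul (fun t : ℝ ↦ (t : ℂ) ^ (k : ℂ) • conj (F t)) s
      (lam * Complex.I ^ k)
    have h' := mellin_cpow_smul (fun t : ℝ ↦ conj (F t)) s k
    beta_reduce at h h' ⊢
    rw [h'] at h
    simp only [smul_eq_mul] at h
    rw [← h]
    congr 1
    ext t
    ring
  rw [← hlhs, ← hrhs]
  refine mellin_congr_Ioi (fun t ht ↦ ?_) s
  rw [hax t ht, mul_zpow, cpow_intCast]
  ring

variable {Γ : Subgroup (GL (Fin 2) ℝ)} {k : ℤ} [Γ.IsArithmetic]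

variable (N) in
/-- **Hecke's functional equation for the pair `(f, f̃)`** (Deligne–Serre 1974, proof of
Thm. 4.6, step (i), the Mellin-transform half).  Let `f` be a cusp form of weight `k ≥ -2` on
an arithmetic subgroup whose cusp `∞` has width `1`, and suppose `f(i/(Nt)) = λ (it)^k conj f(it)`
for `t > 0` (the `W_N`-relation `f(-1/(Nz)) = λ z^k f̃(z)` on the imaginary axis,
`imagAxis_mul_inv_eq_of_fricke_conj`).  Then `Λ(s) = N^{s/2} ∫₀^∞ f(it) t^{s-1} dt` and
`Λ'(s) = N^{s/2} ∫₀^∞ conj f(it) t^{s-1} dt` are entire continuations of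
`Λ_f(s) = N^{s/2} (2π)^{-s} Γ(s) Φ_f(s)` and `Λ_{f̃}(s) = N^{s/2} (2π)^{-s} Γ(s) Φ_{f̃}(s)`
(`Φ_{f̃}(s) = Σ ā_n n^{-s}`), and `Λ(k - s) = a Λ'(s)` for all `s` with
`a = λ i^k N^{-k/2}` ("par transformation de Mellin, on en déduit que `Λ_f(1 - s) = a Λ_{f̃}(s)`").
[cite: DeligneSerreASENS1974, §4 (b) proof of Thm. 4.6 (i)] -/
theorem exists_functionalEquation_of_fricke_conj_imagAxis (hk : -2 ≤ k)
    (hΓ : Γ.strictWidthInfty = 1) (f : CuspForm Γ k) {lam : ℂ}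
    (hax : ∀ t : ℝ, 0 < t →
      f (UpperHalfPlane.ofComplex (Complex.I * ((((N : ℝ) * t)⁻¹ : ℝ) : ℂ))) =
        lam * (Complex.I * t) ^ k * conj (f (UpperHalfPlane.ofComplex (Complex.I * (t : ℂ))))) :
    ∃ Λ ∈ completedCuspFormLContinuations N f, ∃ Λ' ∈ completedConjCuspFormLContinuations N f,
      ∀ s : ℂ, Λ (k - s) = (lam * Complex.I ^ k * (N : ℂ) ^ (-(k : ℂ) / 2)) * Λ' s := by
  refine ⟨_, cpow_mul_mellin_imagAxis_mem_completedCuspFormLContinuations hk hΓ N f, _,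
    cpow_mul_mellin_conj_imagAxis_mem_completedConjCuspFormLContinuations hk hΓ N f, fun s ↦ ?_⟩
  have hN0 : (N : ℂ) ≠ 0 := by exact_mod_cast NeZero.ne N
  have key := cpow_mul_mellin_neg_eq_mellin_conj
    (fun t : ℝ ↦ (f : ℍ → ℂ) (UpperHalfPlane.ofComplex (Complex.I * (t : ℂ)))) k
    (fun t ht ↦ hax t ht) (s - k)
  rw [sub_add_cancel, neg_sub] at key
  have hNs : (N : ℂ) ^ ((k : ℂ) - s) ≠ 0 := by
    rw [Ne, cpow_eq_zero_iff, not_and_or]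
    exact Or.inl hN0
  have hM : mellin (fun t : ℝ ↦ (f : ℍ → ℂ) (UpperHalfPlane.ofComplex (Complex.I * (t : ℂ))))
      (k - s) = ((N : ℂ) ^ ((k : ℂ) - s))⁻¹ * (lam * Complex.I ^ k *
        mellin (fun t : ℝ ↦ conj ((f : ℍ → ℂ) (UpperHalfPlane.ofComplex (Complex.I * (t : ℂ)))))
          s) := by
    rw [← key, inv_mul_cancel_left₀ hNs]
  rw [hM]
  have hexp : (N : ℂ) ^ (((k : ℂ) - s) / 2) * ((N : ℂ) ^ ((k : ℂ) - s))⁻¹ =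
      (N : ℂ) ^ (-(k : ℂ) / 2) * (N : ℂ) ^ (s / 2) := by
    rw [← cpow_neg, ← cpow_add _ _ hN0, ← cpow_add _ _ hN0]
    congr 1
    ring
  linear_combination (lam * Complex.I ^ k *
    mellin (fun t : ℝ ↦ conj ((f : ℍ → ℂ) (UpperHalfPlane.ofComplex (Complex.I * (t : ℂ))))) s) *
      hexp

/-- **The functional equation of `(f, f̃)` from the `W_N`-relation on `ℍ`** (any weight
`k ≥ -2`, any arithmetic `Γ` with cusp width `1` at `∞`): if `f(-1/(Nz)) = λ z^k conj f(-z̄)`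
for all `z ∈ ℍ` then `Λ_f(k - s) = λ i^k N^{-k/2} Λ_{f̃}(s)` for the entire continuations
(`imagAxis_mul_inv_eq_of_fricke_conj` and `exists_functionalEquation_of_fricke_conj_imagAxis`).
[cite: DeligneSerreASENS1974, §4 (b) proof of Thm. 4.6 (i)] -/
theorem exists_functionalEquation_of_fricke_conj (hk : -2 ≤ k)
    (hΓ : Γ.strictWidthInfty = 1) (f : CuspForm Γ k) {lam : ℂ}
    (hW : ∀ z : ℍ, f (glCast (frickeGL N : GL (Fin 2) ℚ) • z) =
      lam * (z : ℂ) ^ k * conj (f ⟨-conj (z : ℂ), by simpa using z.im_pos⟩)) :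
    ∃ Λ ∈ completedCuspFormLContinuations N f, ∃ Λ' ∈ completedConjCuspFormLContinuations N f,
      ∀ s : ℂ, Λ (k - s) = (lam * Complex.I ^ k * (N : ℂ) ^ (-(k : ℂ) / 2)) * Λ' s :=
  exists_functionalEquation_of_fricke_conj_imagAxis N hk hΓ f
    fun _ ht ↦ imagAxis_mul_inv_eq_of_fricke_conj (⇑f) k hW ht

end Fricke

/-! ### Weight one on `Γ₁(N)`: Deligne–Serre's step (i) -/

section WeightOne

variable {N : ℕ} [NeZero N]

/-- **`Λ_f(1 - s) = a Λ_{f̃}(s)` for one weight-one form from its `W_N`-relation** (Deligne–Serre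
1974, proof of Thm. 4.6, (i)): if `f ∈ S_1(Γ₁(N))` satisfies `f(-1/(Nz)) = λ z f̃(z)` on `ℍ`
with `λ ≠ 0`, `f̃(z) = conj f(-z̄)`, then there is `a ≠ 0` (namely `a = λ i N^{-1/2}`) with
`Λ(1 - s) = a Λ'(s)` for entire continuations `Λ` of `completedCuspFormL N f` and `Λ'` of
`completedConjCuspFormL N f`. [cite: DeligneSerreASENS1974, §4 (b) proof of Thm. 4.6 (i)] -/
theorem exists_weightOne_functionalEquation_of_fricke_conj (f : CuspForm (Gamma1 N) 1)
    {lam : ℂ} (hlam : lam ≠ 0)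
    (hW : ∀ z : ℍ, f (glCast (frickeGL N : GL (Fin 2) ℚ) • z) =
      lam * z * conj (f ⟨-conj (z : ℂ), by simpa using z.im_pos⟩)) :
    ∃ a : ℂ, a ≠ 0 ∧ ∃ Λ ∈ completedCuspFormLContinuations N f,
      ∃ Λ' ∈ completedConjCuspFormLContinuations N f, ∀ s : ℂ, Λ (1 - s) = a * Λ' s := by
  have hW' : ∀ z : ℍ, f (glCast (frickeGL N : GL (Fin 2) ℚ) • z) =
      lam * (z : ℂ) ^ (1 : ℤ) * conj (f ⟨-conj (z : ℂ), by simpa using z.im_pos⟩) :=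
    fun z ↦ by rw [zpow_one]; exact hW z
  obtain ⟨Λ, hΛ, Λ', hΛ', hFE⟩ :=
    exists_functionalEquation_of_fricke_conj (N := N) (k := 1) (by norm_num)
      (strictWidthInfty_Gamma1 N) f hW'
  refine ⟨lam * Complex.I * (N : ℂ) ^ (-(1 : ℂ) / 2), ?_, Λ, hΛ, Λ', hΛ', fun s ↦ ?_⟩
  · have hN0 : (N : ℂ) ≠ 0 := by exact_mod_cast NeZero.ne N
    refine mul_ne_zero (mul_ne_zero hlam I_ne_zero) ?_
    rw [Ne, cpow_eq_zero_iff, not_and_or]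
    exact Or.inl hN0
  · have h := hFE s
    rw [Int.cast_one, zpow_one] at h
    exact h

/-- **Deligne–Serre 1974, proof of Thm. 4.6, step (i), second half: the weight-one functional
equation from the `W_N`-relation of newforms.**  "Posons `f̃ = Σ ā_n qⁿ`.  Du fait que `f` est
primitive, il existe une constante `λ ≠ 0` telle que `f(-1/Nz) = λ z f̃(z)`, cf. [12] et [13].
Par transformation de Mellin, on en déduit que `Λ_f(1 - s) = a Λ_{f̃}(s)` … où
`Λ_g(s) = N^{s/2} (2π)^{-s} Γ(s) Φ_g(s)`."  Formally: if every newform `f ∈ S_1(Γ₁(N))`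
satisfies `f(w_N z) = λ z conj f(-z̄)` on `ℍ` for some `λ ≠ 0` (the first half of (i):
Atkin–Lehner–Li theory of the `W_N`-pseudo-eigenvalue, Li 1975, Miyake 1971 — here a
hypothesis), then the named fact `DeligneSerre1974.weightOne_functionalEquation` holds at level
`N` (the Mellin-transform half, proved: `exists_weightOne_functionalEquation_of_fricke_conj`).
[cite: DeligneSerreASENS1974, §4 (b) proof of Thm. 4.6 (i)] -/
theorem DeligneSerre1974.weightOne_functionalEquation_of_fricke_conj
    (hW : ∀ {f : CuspForm (Gamma1 N) 1}, IsNewform1 f → ∃ lam : ℂ, lam ≠ 0 ∧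
      ∀ z : ℍ, f (glCast (frickeGL N : GL (Fin 2) ℚ) • z) =
        lam * z * conj (f ⟨-conj (z : ℂ), by simpa using z.im_pos⟩)) :
    DeligneSerre1974.weightOne_functionalEquation (N := N) := by
  intro f hf
  obtain ⟨lam, hlam, hWf⟩ := hW hf
  exact exists_weightOne_functionalEquation_of_fricke_conj f hlam hWf

end WeightOne

end Literature.NumberTheory.EllipticCurves.ModularForms

end
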